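import Literature.MathematicalPhysics.QuantumFieldTheory.Balaban1983to89.BlockAveragingEMLFibreLawSUN
import Literature.MathematicalPhysics.QuantumFieldTheory.Balaban1983to89.T4ApexPrinted

/-!
# NODE 00 (YM-PLAN Track A) — the READY LAYER of the datum of record `D₀ : T4Continuum.FiniteEpsData F SU(N)`:
# lattices, configurations, Bałaban's PRINTED block averaging (0.4) on `SU(N)`, the renormalisation transformation of
# [Balaban1985Averaging] (10) as the Radon–Nikodym transport, the Wilson start — BY NAME from the tree; NO construction, NO datum

NODE 00 STAGE-1′ MODULE (seat `pub-ymgap-node00-def`, YM-PLAN §2a NODE 00, `NODE00-SCOPING.md` §4; the CONVENTIONS OF RECORD block of the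
root module `Node00Carriers` applies here).
HONEST FRAMING: every definition below is an ABBREVIATION of an existing tree object under a NODE-00 name and every theorem is a
by-name citation of a tree theorem; this file does NOT build a `B16.Construction` or a `FiniteEpsData` (the RG machine — β-functions,
effective actions, χ_k, Bałaban's `R` — is Stage 5; any `FiniteEpsData` assembled from this layer alone would be one more placeholder at
which the pinned end statement (B) is false, `T4FiniteEpsInhabited.not_endStatementBPrinted_stub`).  Nothing of the series is asserted;
one finite four-torus; not continuum on ℝ⁴ ∕ infinite volume ∕ OS ∕ mass gap ∕ Clay.

CONTENT.  For the family `F : T4Family` and `G = SU(N)`, `N ≥ 1`: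
* `cfgOfRecord F N K k` = the step-`k` configurations of the `K`-th approximation = `GaugeField (F.P K) k SU(N)` ([Balaban1987RG1] (0.1), p. 251;
  `T4Continuum.T4Family.P`);
* `avOfRecord F N : (K j : ℕ) → Averaging (F.P K) j SU(N)` = Bałaban's centred block averaging [Balaban1987RG1] (0.3)–(0.4) p. 253 with the
  printed inner operation exp[mean log] on `SU(N)` (`BlockAveraging.blockAvg ExpMeanLog.expMeanLogSU`; its located reading — (0.4) literally
  on the small-field domain, the axial transporter off it — is the tree's, `BlockAveraging` module docstring);
* `avOfRecord_measurable`, `avOfRecord_haarAC` — measurability and the Haar absolute-continuity bracket `HaarAC` on every torus of the family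
  in the standing range, BY NAME (`BlockAveraging.measurable_avgFun`, `BlockAveragingEMLHaarACSUN.haarAC_avgFun_expMeanLogSU_family_of_fibreLaw` at
  `BlockAveragingEMLFibreLawSUN.emlFibreLaw_fin`);
* `TrhoOfRecord F N K k ρ` = the renormalisation transform of a density along `avOfRecord` — [Balaban1985Averaging] (10) p. 19 in the a.e.
  (push-forward) reading `Setup.IsRT`, realised by the Radon–Nikodym transport `AveragingRT.rnTransport`; `isRT_TrhoOfRecord` (for integrable
  densities, `k < K`), `integrable_TrhoOfRecord`, `TrhoOfRecord_nonneg`;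
* `rhoZeroOfRecord F N K g₀ E` = the initial density `ρ₀ = exp[−(1/g₀²)A(U) − E]` ([Balaban1988Convergent] Thm 1 p. 262; `E` the printed
  normalisation constant, a parameter here) = `e^{−E} · Missing.boltzmann (F.P K) (g₀⁻¹ ^ 2)`;
* `isPrintedAveraged₁_of_av` — ANY datum whose averaging maps are `avOfRecord` is printed-averaged in the one-level sense
  (`T4Continuum.FiniteEpsData.IsPrintedAveraged₁`, i.e. binder B1 ∕ node N23 holds BY CONSTRUCTION for every such datum);
* `IsDatumOfRecord₀ D := D.av = avOfRecord F N` (the STAGED datum predicate, Stage 0 — plan position P9) and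
  `isPrintedAveraged_of_isDatumOfRecord₀` (the venue slot `B1_holds` as a one-liner over it).
-/

noncomputable section

open MeasureTheory

namespace Literature.MathematicalPhysics.QuantumFieldTheory.Balaban1983to89.Node00

open T4Continuum BlockAveraging ExpMeanLog AveragingRT T4FiniteEpsInhabited

variable (F : T4Family) (N : ℕ) [NeZero N]

/-- `SU(N)` as the gauge group of record (abbreviation). [folklore] -/
abbrev SU : Type := Matrix.specialUnitaryGroup (Fin N) ℂ

/-- The step-`k` configurations of the `K`-th lattice approximation of the torus family `F`: gauge fields on `T^{(k)}` of
`F.P K` with values in `SU(N)` ([Balaban1987RG1] (0.1)). [cite: Balaban1987RG1, (0.1) p.251] -/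
abbrev cfgOfRecord (K k : ℕ) : Type := GaugeField (F.P K) k (SU N)

/-- **The averaging operations of record**: on every torus `F.P K` and every level `j`, Bałaban's centred block averaging (0.3)–(0.4)
with the printed inner operation exp[mean log] on `SU(N)` — the tree's `BlockAveraging.blockAvg expMeanLogSU`. [cite: Balaban1987RG1, (0.4) p.253] -/
def avOfRecord : (K j : ℕ) → Averaging (F.P K) j (SU N) :=
  fun _ _ => blockAvg expMeanLogSU

/-- Unfolding (`rfl`): the averaging of record is the tree's (0.4) block averaging. [cite: Balaban1987RG1, (0.4) p.253 (bookkeeping)] -/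
theorem avOfRecord_apply (K j : ℕ) : avOfRecord F N K j = blockAvg expMeanLogSU := rfl

/-- The averaging map of record is `BlockAveraging.avgFun expMeanLogSU` (`rfl`). [cite: Balaban1987RG1, (0.4) p.253 (bookkeeping)] -/
theorem avOfRecord_avg (K j : ℕ) :
    (avOfRecord F N K j).avg = (avgFun expMeanLogSU : cfgOfRecord F N K j → cfgOfRecord F N K (j + 1)) := rfl

/-- Measurability of every averaging map of record (`BlockAveraging.measurable_avgFun` with `measurable_expMeanLogSU_E`). [cite: Balaban1987RG1, (0.4) p.253 (kernel property of the tree's averaging, by name)] -/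
theorem avOfRecord_measurable (K j : ℕ) : Measurable (avOfRecord F N K j).avg :=
  measurable_avgFun expMeanLogSU measurable_expMeanLogSU_E

/-- The Haar absolute-continuity bracket `HaarAC` for every averaging map of record in the standing range `k < K`, every `N ≥ 1`
(`BlockAveragingEMLHaarACSUN.haarAC_avgFun_expMeanLogSU_family_of_fibreLaw` at the tree's fibre law
`BlockAveragingEMLFibreLawSUN.emlFibreLaw_fin`). [cite: Balaban1987RG1, (0.4) p.253 (kernel property of the tree's averaging, by name)] -/
theorem avOfRecord_haarAC (K k : ℕ) (hk : k < K) : HaarAC (avOfRecord F N K k).avg :=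
  BlockAveragingEMLHaarACSUN.haarAC_avgFun_expMeanLogSU_family_of_fibreLaw
    BlockAveragingEMLFibreLawSUN.emlFibreLaw_fin F K k hk

/-- **The renormalisation transformation of record** along `avOfRecord`: `(Tρ)(V) = ∫ dU δ(Ū V⁻¹) ρ(U)` of [Balaban1985Averaging] (10) in
the a.e. reading `Setup.IsRT`, realised as the Radon–Nikodym transport `AveragingRT.rnTransport`. [cite: Balaban1985Averaging, (10) p.19] -/
def TrhoOfRecord (K k : ℕ) (ρ : Density (F.P K) k (SU N)) : Density (F.P K) (k + 1) (SU N) :=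
  rnTransport (avOfRecord F N K k).avg ρ

/-- `TrhoOfRecord` IS a renormalisation transform of every integrable density, `k < K` (`T4FiniteEpsInhabited.isRT_rnTransport_of_ac`). [cite: Balaban1985Averaging, (10) p.19] -/
theorem isRT_TrhoOfRecord (K k : ℕ) (hk : k < K) (ρ : Density (F.P K) k (SU N))
    (hρ : Integrable ρ (fieldMeasure (F.P K) k (SU N))) :
    IsRT (avOfRecord F N K k).avg ρ (TrhoOfRecord F N K k ρ) :=
  isRT_rnTransport_of_ac _ (avOfRecord_measurable F N K k) (avOfRecord_haarAC F N K k hk) ρ hρ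

/-- The transform of an integrable density is integrable, `k < K` (`T4FiniteEpsInhabited.integrable_rnTransport_of_ac`). [cite: Balaban1985Averaging, (10) p.19 (kernel property of the tree's transport, by name)] -/
theorem integrable_TrhoOfRecord (K k : ℕ) (hk : k < K) (ρ : Density (F.P K) k (SU N))
    (hρ : Integrable ρ (fieldMeasure (F.P K) k (SU N))) :
    Integrable (TrhoOfRecord F N K k ρ) (fieldMeasure (F.P K) (k + 1) (SU N)) :=
  integrable_rnTransport_of_ac _ (avOfRecord_measurable F N K k) (avOfRecord_haarAC F N K k hk) ρ hρ

/-- The transform of a non-negative density is non-negative (`AveragingRT.rnTransport_nonneg`). [cite: Balaban1985Averaging, (10) p.19 (kernel property of the tree's transport, by name)] -/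
theorem TrhoOfRecord_nonneg (K k : ℕ) (ρ : Density (F.P K) k (SU N)) (h0 : ∀ U, 0 ≤ ρ U) (V : cfgOfRecord F N K (k + 1)) :
    0 ≤ TrhoOfRecord F N K k ρ V :=
  rnTransport_nonneg _ ρ h0 V

/-- **The initial density of record** `ρ₀ = exp[−(1/g₀²)A(U) − E]` of the run with bare coupling `g₀` on the `K`-th torus
([Balaban1988Convergent] Thm 1 p. 262: "the initial density ρ₀ = exp[−(1/g₀²)A − E], where A is the Wilson action, and E is a
normalization constant"), written as `e^{−E}` times the tree's Wilson–Boltzmann weight `Missing.boltzmann` at `β = g₀⁻²`. [cite: Balaban1988Convergent, Thm 1 p.262] -/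
def rhoZeroOfRecord (K : ℕ) (g₀ E : ℝ) : Density (F.P K) 0 (SU N) :=
  fun U => Real.exp (-E) * Missing.boltzmann (F.P K) (g₀⁻¹ ^ 2) U

/-- `ρ₀` is a positive constant times the Wilson weight — the shape `T4Continuum.Realisation.rho_zero` asks for. [cite: Balaban1988Convergent, Thm 1 p.262 (bookkeeping)] -/
theorem rhoZeroOfRecord_shape (K : ℕ) (g₀ E : ℝ) :
    ∃ c : ℝ, 0 < c ∧ ∀ U : cfgOfRecord F N K 0, rhoZeroOfRecord F N K g₀ E U = c * Missing.boltzmann (F.P K) (g₀⁻¹ ^ 2) U :=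
  ⟨Real.exp (-E), Real.exp_pos _, fun _ => rfl⟩

/-- `ρ₀ > 0` pointwise. [cite: Balaban1988Convergent, Thm 1 p.262 (bookkeeping)] -/
theorem rhoZeroOfRecord_pos (K : ℕ) (g₀ E : ℝ) (U : cfgOfRecord F N K 0) : 0 < rhoZeroOfRecord F N K g₀ E U :=
  mul_pos (Real.exp_pos _) (Missing.boltzmann_pos (F.P K) _ U)

/-- **Binder B1 by construction**: ANY finite-`ε` datum on `SU(N)` whose averaging maps are the averaging operations of record is
printed-averaged in the one-level sense (0.4) (`T4Continuum.FiniteEpsData.IsPrintedAveraged₁` = `IsBlockAveraged expMeanLogSU`,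
which by definition is the field equation `∀ K j, D.av K j = blockAvg expMeanLogSU`). [cite: Balaban1987RG1, (0.4) p.253] -/
theorem isPrintedAveraged₁_of_av (D : FiniteEpsData F (SU N)) (hD : D.av = avOfRecord F N) : D.IsPrintedAveraged₁ :=
  fun K j => by rw [hD]; rfl

/-- Hence such a datum is printed-averaged (`IsPrintedAveraged` = one-level ∨ two-level). [cite: Balaban1987RG1, (0.4) p.253] -/
theorem isPrintedAveraged_of_av (D : FiniteEpsData F (SU N)) (hD : D.av = avOfRecord F N) : D.IsPrintedAveraged :=
  Or.inl (isPrintedAveraged₁_of_av F N D hD)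

/-- **«`D` is a datum of record, Stage 0»** (STAGED datum predicate, plan position P9): the datum's averaging maps ARE Bałaban's centred block
averaging of record, `D.av = avOfRecord F N` — the ONE field binder B1 (`IsPrintedAveraged`) reads; every other field of `D` (the construction `D.C`,
`βfun`, the large-field operation `R`, …) unconstrained until the Stage-5 module.  Later datum predicates refine it (`IsDatumOfRecordₛ D → IsDatumOfRecord₀ D`).
[cite: Balaban1987RG1, (0.3)–(0.4) p.253 (objects of record, datum side, Stage 0 dictionary)] -/
def IsDatumOfRecord₀ (D : FiniteEpsData F (SU N)) : Prop := D.av = avOfRecord F N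

/-- **N23 · binder B1 at every datum of record (Stage 0)**: `D.IsPrintedAveraged` — the venue slot `YMDAG.B1_holds` as a one-liner. [cite: Balaban1987RG1, (0.4) p.253] -/
theorem isPrintedAveraged_of_isDatumOfRecord₀ (D : FiniteEpsData F (SU N)) (hD : IsDatumOfRecord₀ F N D) : D.IsPrintedAveraged :=
  isPrintedAveraged_of_av F N D hD

end Literature.MathematicalPhysics.QuantumFieldTheory.Balaban1983to89.Node00

end
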